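import Mathlib
import HarnessLib

/-!
# Continuous multiplicative characters of `ℝˣ`, `ℂˣ` and of `(ℝ^{r₁} × ℂ^{r₂})ˣ` are differentiable
# (one-parameter subgroups of `ℂˣ` are exponentials; Tate's thesis §2.3, quasi-characters `c(α) = c̃(α)‖α‖^s`)

Topic `Analysis/SpecialFunctions`; namespace `Literature.Analysis.SpecialFunctions`.  THEOREMS ONLY (no `def`, no instance, no notation, no axiom,
no `sorry`); everything is proved from Mathlib.  Cell `pub/hodgecm-mathlib`, ENGINE T1 (crux H413 = `stmt-HodgeConjecture-24833`); floor-1 preparation,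
count-neutral, brick «μ_∞ SMOOTH» (LEAD F0P3a-plan (g9) WORD T8-2 (8), 2026-09-01; author B-p17 (g23)) — the generic half; the docking
`differentiableAt_archHeckeValue` (the archimedean component `μ_∞` of a Hecke character is differentiable at every unit of `L ⊗ ℝ`) is the sibling file
`Literature/NumberTheory/Rogawski1990/ArchHeckeValueDifferentiable.lean`.

ROUTE (no classification of circle characters is needed): (a1) a continuous `f : ℝ → ℂ` with `f (s + t) = f s · f t`, `f 0 = 1` is `t ↦ exp (c t)` — the
integration trick of ★ `Literature.Analysis.Fourier.exists_cexp_mul_eq_of_continuous` (there typed for UNITARY `AddChar ℝ Circle`; Hecke characters are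
quasi-characters, so the bare-function form is re-run here); (a2)∕(a3) a multiplicative `χ` on `ℝ ∖ {0}` ∕ `ℂ ∖ {0}`, continuous and non-vanishing there,
is near each point `χ a₀ · exp (c · log (a∕a₀))` ∕ `χ z₀ · exp (c₁ re log (z∕z₀) + c₂ im log (z∕z₀))`, hence real-differentiable (print: «`c(α) = c̃(α)‖α‖^s`»,
«`μ_w(z) = (z∕|z|)^{t}|z|^{s}`»); (a4) on the unit group of `(ι₁ → ℝ) × (ι₂ → ℂ)` a multiplicative continuous non-vanishing `f` factors through the
coordinate characters, `f x = ∏_v χ_v (x.1 v) · ∏_w χ_w (x.2 w)`, so it is differentiable at every unit.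
HONEST LABEL: HC_CM is proved only modulo the printed citations until rung 0 closes; this file is real analysis and pays nothing by itself.

## References
* [TateThesis1967] J. Tate, *Fourier analysis in number fields and Hecke's zeta-functions* (1950), in Cassels–Fröhlich (1967), §2.3 (quasi-characters of
  `k_𝔭ˣ`: `c(α) = c̃(α)‖α‖^s`), §4.3.
* [Bump1997] D. Bump, *Automorphic Forms and Representations* (1997), §3.1, opening discussion and Exercise 3.1.1(f) (continuous characters of `ℝ` are
  exponentials).
-/

set_option autoImplicit false

noncomputable section

open Complex Filter Topology

namespace Literature.Analysis.SpecialFunctions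

/-! ## §1 One-parameter subgroups of `ℂˣ` are exponentials -/

/-- **A continuous homomorphism `(ℝ, +) → (ℂ, ·)` with `f 0 = 1` is an exponential `t ↦ exp (c t)`** (the integration trick: `f(x) ∫₀^δ f = F(x+δ) − F(x)`
for the primitive `F`, so `f` is differentiable with `f′ = c f`).  The bare-function form of ★ `Literature.Analysis.Fourier.exists_cexp_mul_eq_of_continuous`
(unitary characters); no unitarity here. [cite: Bump1997, §3.1, opening discussion and Exercise 3.1.1(f)] [cite: TateThesis1967, §2.3] -/
theorem exists_cexp_mul_eq_of_continuous_of_map_add (f : ℝ → ℂ) (hfc : Continuous f) (hmul : ∀ s t : ℝ, f (s + t) = f s * f t)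
    (hf0 : f 0 = 1) : ∃ c : ℂ, ∀ x : ℝ, f x = cexp (c * x) := by
  -- the primitive `F x = ∫₀ˣ f`
  set F : ℝ → ℂ := fun x => ∫ t in (0 : ℝ)..x, f t with hF
  have hFd : ∀ x, HasDerivAt F (f x) x := fun x => (hfc.integral_hasStrictDerivAt 0 x).hasDerivAt
  -- some `δ` with `F δ ≠ 0`
  obtain ⟨δ, hδ⟩ : ∃ δ, F δ ≠ 0 := by
    by_contra h
    push Not at h
    have hF0 : F = fun _ => 0 := funext h
    have h1 : HasDerivAt F (f 0) 0 := hFd 0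
    rw [hF0] at h1
    have h2 := h1.unique (hasDerivAt_const (0 : ℝ) (0 : ℂ))
    rw [hf0] at h2
    exact one_ne_zero h2
  -- the key identity `f x * F δ = F (x + δ) - F x`
  have hkey : ∀ x, f x * F δ = F (x + δ) - F x := by
    intro x
    have h1 : f x * F δ = ∫ t in (0 : ℝ)..δ, f (x + t) := by
      simp only [hF, ← intervalIntegral.integral_const_mul, hmul]
    rw [h1, intervalIntegral.integral_comp_add_left, add_zero, hF]
    exact (intervalIntegral.integral_interval_sub_left (hfc.intervalIntegrable _ _) (hfc.intervalIntegrable _ _)).symm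
  -- hence `f` is differentiable with `f' = c f`
  set c : ℂ := (f δ - 1) / F δ with hc
  have hfd : ∀ x, HasDerivAt f (c * f x) x := by
    intro x
    have hA : HasDerivAt (fun y => F (y + δ)) (f (x + δ)) x := (hFd (x + δ)).comp_add_const x δ
    have h1 : HasDerivAt (fun y => (F (y + δ) - F y) / F δ) ((f (x + δ) - f x) / F δ) x :=
      (hA.sub (hFd x)).div_const (F δ)
    have h2 : (fun y => (F (y + δ) - F y) / F δ) = f := by
      funext y
      rw [← hkey y, mul_div_cancel_right₀ _ hδ]
    rw [h2] at h1
    convert h1 using 1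
    rw [hc, hmul]
    field_simp
  -- `f x * exp (-c x)` has zero derivative, so `f x = exp (c x)`
  have hg : ∀ x : ℝ, HasDerivAt (fun y : ℝ => f y * cexp (-c * y)) 0 x := by
    intro x
    have h1 : HasDerivAt (fun y : ℝ => cexp (-c * y)) (cexp (-c * x) * (-c)) x := by
      have h := ((hasDerivAt_id x).ofReal_comp.const_mul (-c)).cexp
      simpa using h
    exact ((hfd x).fun_mul h1).congr_deriv (by ring)
  have hgc := is_const_of_deriv_eq_zero (fun x => (hg x).differentiableAt) (fun x => (hg x).deriv)
  refine ⟨c, fun x => ?_⟩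
  have h1 := hgc x 0
  simp only [Complex.ofReal_zero, mul_zero, Complex.exp_zero, mul_one, hf0] at h1
  calc f x = f x * cexp (-c * x) * cexp (c * x) := by
        rw [mul_assoc, ← Complex.exp_add, neg_mul, neg_add_cancel, Complex.exp_zero, mul_one]
    _ = cexp (c * x) := by rw [h1, one_mul]

/-- A continuous homomorphism `(ℝ, +) → (ℂ, ·)` with `f 0 = 1` is differentiable. [cite: Bump1997, §3.1 Exercise 3.1.1(f)] -/
theorem differentiable_of_continuous_of_map_add (f : ℝ → ℂ) (hfc : Continuous f) (hmul : ∀ s t : ℝ, f (s + t) = f s * f t)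
    (hf0 : f 0 = 1) : Differentiable ℝ f := by
  obtain ⟨c, hc⟩ := exists_cexp_mul_eq_of_continuous_of_map_add f hfc hmul hf0
  intro x
  have h := (((hasDerivAt_id x).ofReal_comp.const_mul c).cexp).differentiableAt
  have hf : f = fun y : ℝ => cexp (c * ((id y : ℝ) : ℂ)) := funext fun y => by rw [hc]; rfl
  rw [hf]
  exact h

/-! ## §2 Multiplicative characters of `ℝ ∖ {0}` and `ℂ ∖ {0}` -/

/-- `χ 1 = 1` for a multiplicative non-vanishing `χ`. [cite: TateThesis1967, §2.3] -/
theorem map_one_of_map_mul_of_ne_zero {K : Type*} [Field K] {χ : K → ℂ} (hmul : ∀ a b : K, a ≠ 0 → b ≠ 0 → χ (a * b) = χ a * χ b)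
    (hne : ∀ a : K, a ≠ 0 → χ a ≠ 0) : χ 1 = 1 := by
  have h := hmul 1 1 one_ne_zero one_ne_zero
  rw [mul_one] at h
  exact (mul_right_eq_self₀.mp h.symm).resolve_right (hne 1 one_ne_zero)

/-- **A continuous multiplicative character of `ℝˣ` is differentiable**: if `χ : ℝ → ℂ` is multiplicative and non-vanishing on `ℝ ∖ {0}` and continuous
at every non-zero point, then `χ` is (real-)differentiable at every `a₀ ≠ 0` — near `a₀`, `χ a = χ a₀ · exp (c · log (a ∕ a₀))` with the exponent `c` of the
one-parameter subgroup `t ↦ χ (eᵗ)` (§1). [cite: TateThesis1967, §2.3] -/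
theorem differentiableAt_of_map_mul_real {χ : ℝ → ℂ} (hmul : ∀ a b : ℝ, a ≠ 0 → b ≠ 0 → χ (a * b) = χ a * χ b)
    (hcont : ∀ a : ℝ, a ≠ 0 → ContinuousAt χ a) (hne : ∀ a : ℝ, a ≠ 0 → χ a ≠ 0) {a₀ : ℝ} (ha : a₀ ≠ 0) :
    DifferentiableAt ℝ χ a₀ := by
  have h1 : χ 1 = 1 := map_one_of_map_mul_of_ne_zero hmul hne
  -- the one-parameter subgroup `t ↦ χ (exp t)`
  have hφc : Continuous fun t : ℝ => χ (Real.exp t) :=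
    continuous_iff_continuousAt.mpr fun t => (hcont _ (Real.exp_pos t).ne').comp (Real.continuous_exp.continuousAt)
  obtain ⟨c, hc⟩ := exists_cexp_mul_eq_of_continuous_of_map_add (fun t => χ (Real.exp t)) hφc
    (fun s t => by simp only [Real.exp_add, hmul _ _ (Real.exp_pos s).ne' (Real.exp_pos t).ne']) (by simp only [Real.exp_zero, h1])
  -- near `a₀`: `χ a = χ a₀ * exp (c * log (a / a₀))`
  have hev : χ =ᶠ[𝓝 a₀] fun a => χ a₀ * cexp (c * (Real.log (a / a₀) : ℂ)) := by
    have hopen : IsOpen {a : ℝ | 0 < a / a₀} := isOpen_lt continuous_const (continuous_id.div_const a₀)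
    filter_upwards [hopen.mem_nhds (show 0 < a₀ / a₀ by rw [div_self ha]; exact one_pos)] with a hpos
    have hq : a / a₀ ≠ 0 := hpos.ne'
    calc χ a = χ (a₀ * (a / a₀)) := by rw [mul_div_cancel₀ a ha]
      _ = χ a₀ * χ (Real.exp (Real.log (a / a₀))) := by rw [hmul _ _ ha hq, Real.exp_log hpos]
      _ = χ a₀ * cexp (c * (Real.log (a / a₀) : ℂ)) := by rw [hc]
  refine (hev.differentiableAt_iff).mpr ?_
  have hlog : DifferentiableAt ℝ (fun a : ℝ => Real.log (a / a₀)) a₀ := by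
    have hdiv : DifferentiableAt ℝ (fun a : ℝ => a / a₀) a₀ := differentiableAt_id.div_const a₀
    exact hdiv.log (by rw [div_self ha]; exact one_ne_zero)
  have hofReal : DifferentiableAt ℝ (fun a : ℝ => (Real.log (a / a₀) : ℂ)) a₀ := Complex.ofRealCLM.differentiableAt.comp a₀ hlog
  exact ((hofReal.const_mul c).cexp).const_mul (χ a₀)

/-- **A continuous multiplicative character of `ℂˣ` is real-differentiable**: if `χ : ℂ → ℂ` is multiplicative and non-vanishing on `ℂ ∖ {0}` and
continuous at every non-zero point, then `χ` is `ℝ`-differentiable at every `z₀ ≠ 0` — for `z ≠ 0`,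
`χ z = χ z₀ · exp (c₁ · re (log (z∕z₀))) · exp (c₂ · im (log (z∕z₀)))` with the exponents of the one-parameter subgroups `t ↦ χ (eᵗ)`, `s ↦ χ (e^{is})` (§1):
the differentiable form of «`μ_w(z) = (z∕|z|)^t · |z|^s`». [cite: TateThesis1967, §2.3] -/
theorem differentiableAt_of_map_mul_complex {χ : ℂ → ℂ} (hmul : ∀ a b : ℂ, a ≠ 0 → b ≠ 0 → χ (a * b) = χ a * χ b)
    (hcont : ∀ a : ℂ, a ≠ 0 → ContinuousAt χ a) (hne : ∀ a : ℂ, a ≠ 0 → χ a ≠ 0) {z₀ : ℂ} (hz : z₀ ≠ 0) :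
    DifferentiableAt ℝ χ z₀ := by
  have h1 : χ 1 = 1 := map_one_of_map_mul_of_ne_zero hmul hne
  -- the two one-parameter subgroups
  have hφ₁c : Continuous fun t : ℝ => χ (cexp (t : ℂ)) :=
    continuous_iff_continuousAt.mpr fun t =>
      ContinuousAt.comp (f := fun t : ℝ => cexp (t : ℂ)) (hcont _ (Complex.exp_ne_zero _))
        (Complex.continuous_exp.comp Complex.continuous_ofReal).continuousAt
  have hφ₂c : Continuous fun s : ℝ => χ (cexp ((s : ℂ) * I)) :=
    continuous_iff_continuousAt.mpr fun s =>
      ContinuousAt.comp (f := fun s : ℝ => cexp ((s : ℂ) * I)) (hcont _ (Complex.exp_ne_zero _))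
        (Complex.continuous_exp.comp (Complex.continuous_ofReal.mul continuous_const)).continuousAt
  obtain ⟨c₁, hc₁⟩ := exists_cexp_mul_eq_of_continuous_of_map_add (fun t => χ (cexp (t : ℂ))) hφ₁c
    (fun s t => by simp only [Complex.ofReal_add, Complex.exp_add, hmul _ _ (Complex.exp_ne_zero _) (Complex.exp_ne_zero _)])
    (by simp only [Complex.ofReal_zero, Complex.exp_zero, h1])
  obtain ⟨c₂, hc₂⟩ := exists_cexp_mul_eq_of_continuous_of_map_add (fun s => χ (cexp ((s : ℂ) * I))) hφ₂c
    (fun s t => by simp only [Complex.ofReal_add, add_mul, Complex.exp_add, hmul _ _ (Complex.exp_ne_zero _) (Complex.exp_ne_zero _)])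
    (by simp only [Complex.ofReal_zero, zero_mul, Complex.exp_zero, h1])
  -- for `z ≠ 0`: `χ z = χ z₀ * exp (c₁ re ℓ) * exp (c₂ im ℓ)`, `ℓ = log (z / z₀)`
  have hev : χ =ᶠ[𝓝 z₀] fun z => χ z₀ * (cexp (c₁ * ((Complex.log (z / z₀)).re : ℂ)) * cexp (c₂ * ((Complex.log (z / z₀)).im : ℂ))) := by
    filter_upwards [isOpen_ne.mem_nhds hz] with z hzne
    have hq : z / z₀ ≠ 0 := div_ne_zero hzne hz
    set ℓ := Complex.log (z / z₀) with hℓ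
    have hsplit : cexp ℓ = cexp (ℓ.re : ℂ) * cexp ((ℓ.im : ℂ) * I) := by
      rw [← Complex.exp_add, Complex.re_add_im]
    calc χ z = χ (z₀ * (z / z₀)) := by rw [mul_div_cancel₀ z hz]
      _ = χ z₀ * χ (cexp ℓ) := by rw [hmul _ _ hz hq, hℓ, Complex.exp_log hq]
      _ = χ z₀ * (χ (cexp (ℓ.re : ℂ)) * χ (cexp ((ℓ.im : ℂ) * I))) := by
          rw [hsplit, hmul _ _ (Complex.exp_ne_zero _) (Complex.exp_ne_zero _)]
      _ = χ z₀ * (cexp (c₁ * (ℓ.re : ℂ)) * cexp (c₂ * (ℓ.im : ℂ))) := by rw [hc₁, hc₂]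
  refine (hev.differentiableAt_iff).mpr ?_
  have hlog : DifferentiableAt ℝ (fun z : ℂ => Complex.log (z / z₀)) z₀ := by
    have hdiv : DifferentiableAt ℂ (fun z : ℂ => z / z₀) z₀ := differentiableAt_id.div_const z₀
    exact (hdiv.clog (by rw [div_self hz]; exact Complex.one_mem_slitPlane)).restrictScalars ℝ
  have hre : DifferentiableAt ℝ (fun z : ℂ => ((Complex.log (z / z₀)).re : ℂ)) z₀ :=
    Complex.ofRealCLM.differentiableAt.comp z₀ (Complex.reCLM.differentiableAt.comp z₀ hlog)
  have him : DifferentiableAt ℝ (fun z : ℂ => ((Complex.log (z / z₀)).im : ℂ)) z₀ :=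
    Complex.ofRealCLM.differentiableAt.comp z₀ (Complex.imCLM.differentiableAt.comp z₀ hlog)
  exact ((hre.const_mul c₁).cexp.mul (him.const_mul c₂).cexp).const_mul (χ z₀)

/-! ## §3 Multiplicative functions on the unit group of `ℝ^{r₁} × ℂ^{r₂}` -/

section Mixed

variable {ι₁ ι₂ : Type*} [Fintype ι₁] [Fintype ι₂] [DecidableEq ι₁] [DecidableEq ι₂]

omit [Fintype ι₁] [Fintype ι₂] [DecidableEq ι₁] [DecidableEq ι₂] in
/-- Units of `(ι₁ → ℝ) × (ι₂ → ℂ)`: all coordinates non-zero. [folklore] -/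
private theorem isUnit_mixed_iff (x : (ι₁ → ℝ) × (ι₂ → ℂ)) : IsUnit x ↔ (∀ v, x.1 v ≠ 0) ∧ ∀ w, x.2 w ≠ 0 := by
  rw [Prod.isUnit_iff, Pi.isUnit_iff, Pi.isUnit_iff]
  simp only [isUnit_iff_ne_zero]

omit [Fintype ι₁] [Fintype ι₂] [DecidableEq ι₂] in
/-- The coordinate element `(δ_v a, 1)` is a unit for `a ≠ 0`. [folklore] -/
private theorem isUnit_inl_mulSingle (v : ι₁) {a : ℝ} (ha : a ≠ 0) :
    IsUnit (((Pi.mulSingle v a : ι₁ → ℝ), (1 : ι₂ → ℂ)) : (ι₁ → ℝ) × (ι₂ → ℂ)) := by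
  rw [isUnit_mixed_iff]
  refine ⟨fun v' => ?_, fun w => one_ne_zero⟩
  change (Pi.mulSingle v a : ι₁ → ℝ) v' ≠ 0
  by_cases h : v' = v
  · subst h; rwa [Pi.mulSingle_eq_same]
  · rw [Pi.mulSingle_eq_of_ne h]; exact one_ne_zero

omit [Fintype ι₁] [Fintype ι₂] [DecidableEq ι₁] in
/-- The coordinate element `(1, δ_w z)` is a unit for `z ≠ 0`. [folklore] -/
private theorem isUnit_inr_mulSingle (w : ι₂) {z : ℂ} (hz : z ≠ 0) :
    IsUnit (((1 : ι₁ → ℝ), (Pi.mulSingle w z : ι₂ → ℂ)) : (ι₁ → ℝ) × (ι₂ → ℂ)) := by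
  rw [isUnit_mixed_iff]
  refine ⟨fun v => one_ne_zero, fun w' => ?_⟩
  change (Pi.mulSingle w z : ι₂ → ℂ) w' ≠ 0
  by_cases h : w' = w
  · subst h; rwa [Pi.mulSingle_eq_same]
  · rw [Pi.mulSingle_eq_of_ne h]; exact one_ne_zero

/-- A multiplicative function on units turns finite products of units into products. [folklore] -/
private theorem map_prod_of_isUnit {M : Type*} [CommMonoid M] {f : M → ℂ} (hmul : ∀ x y : M, IsUnit x → IsUnit y → f (x * y) = f x * f y)
    (h1 : f 1 = 1) {κ : Type*} (s : Finset κ) (g : κ → M) (hg : ∀ i ∈ s, IsUnit (g i)) :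
    f (∏ i ∈ s, g i) = ∏ i ∈ s, f (g i) := by
  classical
  induction s using Finset.induction_on with
  | empty => simp [h1]
  | insert j s hj ih =>
    rw [Finset.prod_insert hj, Finset.prod_insert hj,
      hmul _ _ (hg j (Finset.mem_insert_self j s)) (IsUnit.prod_iff.mpr fun i hi => hg i (Finset.mem_insert_of_mem hi)),
      ih fun i hi => hg i (Finset.mem_insert_of_mem hi)]

/-- **A continuous multiplicative function on the unit group of `ℝ^{r₁} × ℂ^{r₂}` is differentiable at every unit.**  If `f : (ι₁ → ℝ) × (ι₂ → ℂ) → ℂ` is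
multiplicative, non-vanishing and continuous on units, then on the (open) unit group `f x = ∏_v χ_v (x.1 v) · ∏_w χ_w (x.2 w)` with the coordinate characters
`χ_v a = f (δ_v a, 1)`, `χ_w z = f (1, δ_w z)`, which are differentiable by §2.  (Applied in the sibling file to `μ_∞` on `L ⊗ ℝ = ℝ^{r₁} × ℂ^{r₂}`.)
[cite: TateThesis1967, §2.3; §4.3] -/
theorem differentiableAt_of_map_mul_of_isUnit {f : (ι₁ → ℝ) × (ι₂ → ℂ) → ℂ} (hmul : ∀ x y : (ι₁ → ℝ) × (ι₂ → ℂ), IsUnit x → IsUnit y → f (x * y) = f x * f y)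
    (hcont : ∀ x : (ι₁ → ℝ) × (ι₂ → ℂ), IsUnit x → ContinuousAt f x) (hne : ∀ x : (ι₁ → ℝ) × (ι₂ → ℂ), IsUnit x → f x ≠ 0)
    {x₀ : (ι₁ → ℝ) × (ι₂ → ℂ)} (hx₀ : IsUnit x₀) : DifferentiableAt ℝ f x₀ := by
  have h1 : f 1 = 1 := by
    have h := hmul 1 1 isUnit_one isUnit_one
    rw [mul_one] at h
    exact (mul_right_eq_self₀.mp h.symm).resolve_right (hne 1 isUnit_one)
  -- coordinate characters `χ_v a = f (δ_v a, 1)`, `χ_w z = f (1, δ_w z)` are differentiable off `0`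
  have hχ₁d : ∀ v {a : ℝ}, a ≠ 0 → DifferentiableAt ℝ (fun a : ℝ => f (((Pi.mulSingle v a : ι₁ → ℝ), (1 : ι₂ → ℂ)) : (ι₁ → ℝ) × (ι₂ → ℂ))) a := by
    intro v a ha
    refine differentiableAt_of_map_mul_real (fun a b ha hb => ?_) (fun a ha => ?_) (fun a ha => hne _ (isUnit_inl_mulSingle v ha)) ha
    · rw [← hmul _ _ (isUnit_inl_mulSingle v ha) (isUnit_inl_mulSingle v hb), Prod.mk_mul_mk, ← Pi.mulSingle_mul, mul_one]
    · exact ContinuousAt.comp (f := fun a : ℝ => (((Pi.mulSingle v a : ι₁ → ℝ), (1 : ι₂ → ℂ)) : (ι₁ → ℝ) × (ι₂ → ℂ))) (hcont _ (isUnit_inl_mulSingle v ha))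
        ((continuous_mulSingle v).prodMk continuous_const).continuousAt
  have hχ₂d : ∀ w {z : ℂ}, z ≠ 0 → DifferentiableAt ℝ (fun z : ℂ => f (((1 : ι₁ → ℝ), (Pi.mulSingle w z : ι₂ → ℂ)) : (ι₁ → ℝ) × (ι₂ → ℂ))) z := by
    intro w z hz
    refine differentiableAt_of_map_mul_complex (fun a b ha hb => ?_) (fun a ha => ?_) (fun a ha => hne _ (isUnit_inr_mulSingle w ha)) hz
    · rw [← hmul _ _ (isUnit_inr_mulSingle w ha) (isUnit_inr_mulSingle w hb), Prod.mk_mul_mk, ← Pi.mulSingle_mul, mul_one]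
    · exact ContinuousAt.comp (f := fun a : ℂ => (((1 : ι₁ → ℝ), (Pi.mulSingle w a : ι₂ → ℂ)) : (ι₁ → ℝ) × (ι₂ → ℂ))) (hcont _ (isUnit_inr_mulSingle w ha))
        (continuous_const.prodMk (continuous_mulSingle w)).continuousAt
  -- factorisation on units
  have hfac : ∀ x : (ι₁ → ℝ) × (ι₂ → ℂ), IsUnit x →
      f x = (∏ v, f (((Pi.mulSingle v (x.1 v) : ι₁ → ℝ), (1 : ι₂ → ℂ)) : (ι₁ → ℝ) × (ι₂ → ℂ))) * ∏ w, f (((1 : ι₁ → ℝ), (Pi.mulSingle w (x.2 w) : ι₂ → ℂ)) : (ι₁ → ℝ) × (ι₂ → ℂ)) := by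
    intro x hx
    have hx' := (isUnit_mixed_iff x).mp hx
    have hsplit : x = ((x.1, 1) : (ι₁ → ℝ) × (ι₂ → ℂ)) * (1, x.2) := by rw [Prod.mk_mul_mk, mul_one, one_mul]
    have hu1 : IsUnit ((x.1, 1) : (ι₁ → ℝ) × (ι₂ → ℂ)) := by
      rw [isUnit_mixed_iff]; exact ⟨hx'.1, fun _ => one_ne_zero⟩
    have hu2 : IsUnit ((1, x.2) : (ι₁ → ℝ) × (ι₂ → ℂ)) := by
      rw [isUnit_mixed_iff]; exact ⟨fun _ => one_ne_zero, hx'.2⟩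
    have hp1 : ((x.1, 1) : (ι₁ → ℝ) × (ι₂ → ℂ)) = ∏ v, MonoidHom.inl (ι₁ → ℝ) (ι₂ → ℂ) (Pi.mulSingle v (x.1 v)) := by
      rw [← map_prod, Finset.univ_prod_mulSingle]; rfl
    have hp2 : ((1, x.2) : (ι₁ → ℝ) × (ι₂ → ℂ)) = ∏ w, MonoidHom.inr (ι₁ → ℝ) (ι₂ → ℂ) (Pi.mulSingle w (x.2 w)) := by
      rw [← map_prod, Finset.univ_prod_mulSingle]; rfl
    calc f x = f (((x.1, 1) : (ι₁ → ℝ) × (ι₂ → ℂ)) * (1, x.2)) := by rw [Prod.mk_mul_mk, mul_one, one_mul]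
      _ = f ((x.1, 1) : (ι₁ → ℝ) × (ι₂ → ℂ)) * f ((1, x.2) : (ι₁ → ℝ) × (ι₂ → ℂ)) := hmul _ _ hu1 hu2
      _ = f (∏ v, MonoidHom.inl (ι₁ → ℝ) (ι₂ → ℂ) (Pi.mulSingle v (x.1 v))) *
            f (∏ w, MonoidHom.inr (ι₁ → ℝ) (ι₂ → ℂ) (Pi.mulSingle w (x.2 w))) := by rw [hp1, hp2]
      _ = (∏ v, f (MonoidHom.inl (ι₁ → ℝ) (ι₂ → ℂ) (Pi.mulSingle v (x.1 v)))) *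
            ∏ w, f (MonoidHom.inr (ι₁ → ℝ) (ι₂ → ℂ) (Pi.mulSingle w (x.2 w))) := by
          rw [map_prod_of_isUnit hmul h1 Finset.univ (fun v => MonoidHom.inl (ι₁ → ℝ) (ι₂ → ℂ) (Pi.mulSingle v (x.1 v)))
              fun v _ => isUnit_inl_mulSingle v (hx'.1 v),
            map_prod_of_isUnit hmul h1 Finset.univ (fun w => MonoidHom.inr (ι₁ → ℝ) (ι₂ → ℂ) (Pi.mulSingle w (x.2 w)))
              fun w _ => isUnit_inr_mulSingle w (hx'.2 w)]
      _ = _ := rfl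
  -- units are open; differentiate the factorised form
  have hev : f =ᶠ[𝓝 x₀] fun x =>
      (∏ v, f (((Pi.mulSingle v (x.1 v) : ι₁ → ℝ), (1 : ι₂ → ℂ)) : (ι₁ → ℝ) × (ι₂ → ℂ))) * ∏ w, f (((1 : ι₁ → ℝ), (Pi.mulSingle w (x.2 w) : ι₂ → ℂ)) : (ι₁ → ℝ) × (ι₂ → ℂ)) := by
    filter_upwards [Units.isOpen.mem_nhds hx₀] with x hx
    exact hfac x hx
  refine (hev.differentiableAt_iff).mpr ?_
  have hx₀' := (isUnit_mixed_iff x₀).mp hx₀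
  have hd1 : ∀ v, DifferentiableAt ℝ (fun x : (ι₁ → ℝ) × (ι₂ → ℂ) => f (((Pi.mulSingle v (x.1 v) : ι₁ → ℝ), (1 : ι₂ → ℂ)) : (ι₁ → ℝ) × (ι₂ → ℂ))) x₀ := by
    intro v
    have hk1 : DifferentiableAt ℝ (fun g : ι₁ → ℝ => g v) x₀.1 := differentiableAt_apply (𝕜 := ℝ) v x₀.1
    have hk : DifferentiableAt ℝ (fun x : (ι₁ → ℝ) × (ι₂ → ℂ) => x.1 v) x₀ := hk1.comp x₀ differentiableAt_fst
    have h := DifferentiableAt.comp x₀ (hχ₁d v (hx₀'.1 v)) hk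
    exact h
  have hd2 : ∀ w, DifferentiableAt ℝ (fun x : (ι₁ → ℝ) × (ι₂ → ℂ) => f (((1 : ι₁ → ℝ), (Pi.mulSingle w (x.2 w) : ι₂ → ℂ)) : (ι₁ → ℝ) × (ι₂ → ℂ))) x₀ := by
    intro w
    have hk1 : DifferentiableAt ℝ (fun g : ι₂ → ℂ => g w) x₀.2 := differentiableAt_apply (𝕜 := ℝ) w x₀.2
    have hk : DifferentiableAt ℝ (fun x : (ι₁ → ℝ) × (ι₂ → ℂ) => x.2 w) x₀ := hk1.comp x₀ differentiableAt_snd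
    have h := DifferentiableAt.comp x₀ (hχ₂d w (hx₀'.2 w)) hk
    exact h
  exact (HasFDerivAt.finsetProd fun v _ => (hd1 v).hasFDerivAt).differentiableAt.mul
    (HasFDerivAt.finsetProd fun w _ => (hd2 w).hasFDerivAt).differentiableAt

end Mixed

end Literature.Analysis.SpecialFunctions
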